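import Literature.MathematicalPhysics.QuantumFieldTheory.BalabanImbrieJaffe1984to88.BIJ85GaugeFnBound513
import Literature.MathematicalPhysics.QuantumFieldTheory.BalabanImbrieJaffe1984to88.BIJ85Sect7Statements

/-!
# `BalabanImbrieJaffe1984to88.BIJ85Ineq724Proof` — T. Bałaban, J. Imbrie, A. Jaffe, *Renormalization of the Higgs model: minimizers,
propagators and the stability of mean field theory*, Commun. Math. Phys. **97** (1985) 299–329 [BalabanImbrieJaffe1985]: **(7.2.4)**
p. 326 — the kernel `D_k` of the gauge transformation `λ` of (5.1.1)/(5.1.4), `λ(x) = (D_kB)(x)`, and its exponential decay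
`|D_k(x,b)| ≤ Me^{−δdist(x,b)}` *"from (5.1.4) and (7.2.2)"*, PROVED as a MODEL INSTANCE of `…BIJ85Sect7Statements.KernelData.Ineq724`
on the V1 lattice calculus (file 2 of 2 of row C1.Eq7.2.4; file 1 = `…BIJ85GaugeFnBound513`: boundedness and locality of `λ(A)`)

statement-level skeleton of published theorems with citation tags; proofs where landed; nothing here is a claim about the Yang–Mills mass gap

PDF held: `paper:balaban1985-cmp97-bij-higgs-minimizers` (journal page = PDF page + 298); pp. 325–326 [PDF 27–28] read as images
(`run/shared/lean/pub/pub-balaban/t4/b2b-balaban-t4-lit2/renders/bij1985/1985-cmp97-bij-higgs-minimizers-p027-x2.png`,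
`run/shared/lean/pub/lit-balaban/lit-balaban-r15/pages/1985-cmp97-bij-higgs-minimizers-p028-x2.png`).

THE PRINTED TEXT (pp. 325–326, verbatim).  *"The minimizer H_k can be expressed as an integral kernel. For x ∈ T_η, (H_kB)_μ(x) =
Σ_{y∈T₁^{(k)},ν} H_{k,μν}(x; y)B_ν(y). (7.2.1) The kernel H_{k,μν}(x,y) and its gradient decay exponentially. In particular there exists δ > 0
and for 0 ≤ α < 1 a constant M = M(α) < ∞ such that for |x − x′| ≤ 1, |H_{k,μν}(x,y)| + |∇H_{k,μν}(x,y)| + |x − x′|^{−α}|∇H_{k,μν}(x,y) −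
∇H_{k,μν}(x′,y)| ≤ Me^{−δ|x−y|}. (7.2.2) This inequality is a consequence of Proposition 1.2 and the representation (1.103) of [6I]. …
The gauge transformation λ in (5.1.1) is bounded and depends on B through an exponentially decaying kernel D_k: λ(x) = (D_kB)(x),
|D_k(x, b)| ≤ Me^{−δdist(x,b)}. (7.2.4) This estimate follows from (5.1.4) and (7.2.2)."*

CITATION HEADER (lean-in-tree rule).  Phase-2 file of the lit-balaban TYPED SKELETON (HOME `run/shared/lean/pub/lit-balaban/`), SKELETON row
**`C1.Eq7.2.4`** (reader r15 `ROWS-C1`: `typed p239582`, decl of record `…BIJ85Sect7Statements.KernelData.Ineq724 (M δ)` over the ABSTRACT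
carrier `KernelData` of Sect. 7.2), seat p08 gen 3 (unit `lit-balaban-p08`; TAKING HOME/STATUS.md 2026-08-21T04:18:37Z), kind «model-instance».
THE INSTANCE (`kernelData`): `SiteEta` = the η-lattice `Site P 0`, `SiteU` = the unit lattice `Site P k`, `BondU` = `PBond P k`, `Dir` = `Fin d`;
`H` = a given kernel `H : Fin d → Fin d → Site P 0 → Site P k → ℝ` acting by (7.2.1) (`applyKernel`); **`D` = `Dk c k H`, the kernel of
`B ↦ λ(H_kB)` COMPUTED from the concrete gauge function `λ(·) = …BIJ85GaugeFunction5113.lamOf c k` of (5.1.13)** ((5.1.4) = (5.1.13) at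
`A = H_kB`; lattice factor `c` of `∂` explicit, `c = η⁻¹ = L^k` in print) by `D_k(x, b) := λ(H_k(·; b))(x)`; the distances `distEU`, `distEB`
(and `distEta`, `distU`), the gradient data `gradH`, `gradHDiff` and the propagator kernel `C` of the carrier are PARAMETERS of the instance
(they do not enter (7.2.4)).  WHAT IS PROVED (standing range `k ≤ m + K`):
* **`eq724_repr`** — the first clause of (7.2.4): `λ(H_kB)(x) = Σ_b D_k(x,b)·B(b)` for every unit-lattice field `B` (linearity of `λ(·)`,
  `…BIJ85Eq5113Proof.lamOf_add/smul`);
* **`abs_Dk_le`** — the decay mechanism *"from (5.1.4) and (7.2.2)"*: if `|H_{k,μν}(x″; y)| ≤ M·exp(−δ·ρ(x″_k, y))` for all `μ, ν, x″, y`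
  (the `|H|`-member of (7.2.2), decay measured from the unit block `B^k(x″_k) ∋ x″` through ANY function `ρ` on `T₁^{(k)} × T₁^{(k)}`), then
  `|D_k(x, b)| ≤ Λ·M·exp(−δ·ρ(x_k, b₋))` with `Λ = 2·d·((L−1)/2)·Σ_{j<k}L^j/|c|` (`= d(1 − L^{−k})` at `c = L^k`, `abs_Dk_le_unit`) — because
  `λ(·)(x)` reads its argument only on the η-bonds of `B^k(x_k)` (`…BIJ85GaugeFnBound513.lamOf_congr_tower`), where the hypothesis is the
  constant bound `M·exp(−δ·ρ(x_k, b₋))`, and `λ` is bounded (`…norm_lamOf_le`);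
* **`ineq724`** — `KernelData.Ineq724 (Λ·M·e^{δ(s+s′)}) δ` for the instance, from the `|H|`-member of `(7.2.2)` at `(M, δ)` in the instance's
  own distances, WHENEVER those distances are tied to the block geometry by `ρ(x″_k, y) ≤ distEU x″ y + s` and `distEB x b ≤ ρ(x_k, b₋) + s′`
  (e.g. `s = s′ = 0` for block-level distances, `ineq724_block`; `s, s′` = one unit-block diameter for point distances); `δ ≥ 0`, `M ≥ 0`.
* v1.1 (append-only) §4 — **`ineq724_tdist`**: the same with the PRINTED reading of the distances (the torus `ℓ¹` distance of `T_η` from the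
  fine site `x` itself, in unit-lattice units, to a placement `ι` of `T₁^{(k)}`): constant `Λ·e^{δd}·M`; via `abs_Dk_le_fine` (sub-block excess
  `R`) and the torus-distance lemmas `tdist_le_of_blk_eq`/`eta_tdist_excess_le` (the `ℓ¹` lemmas were contributed by seat p03 gen 2).
NOT PROVED HERE OR ANYWHERE IN THE TREE: (7.2.2) itself (*"a consequence of Proposition 1.2 and the representation (1.103) of [6I]"* =
[Balaban1984PropagatorsI]; SKELETON row C1.Eq7.2.1-7.2.2, `typed` by reference) — it is the displayed hypothesis `hH`; nor that the given
kernel `H` IS the Landau minimizer of (4.4.2) (the instance is parametrised by `H`).  No new Prop-valued fact; nothing of the paper is asserted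
beyond the kernel-checked statements below.
-/

namespace Literature.MathematicalPhysics.QuantumFieldTheory.BalabanImbrieJaffe1984to88.BIJ85Ineq724Proof

open Literature.MathematicalPhysics.QuantumFieldTheory.Balaban1983to89
open LatticeFieldCalculus B5Eq120IterProof BIJ85AxialPropagator411 BIJ85GaugeFunction5113 BIJ85Eq5113Proof BIJ85GaugeFnBound513
open BIJ85Sect7Statements

variable {P : Params}

/-! ## §1  (7.2.1): `H_k` as a kernel, and the kernel `D_k` of `B ↦ λ(H_kB)` -/

/-- **(7.2.1)** p. 325 [PDF 27], verbatim: *"The minimizer H_k can be expressed as an integral kernel. For x ∈ T_η, (H_kB)_μ(x) =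
Σ_{y∈T₁^{(k)},ν} H_{k,μν}(x; y)B_ν(y). (7.2.1)"* — the η-lattice bond field `H_kB` of a unit-lattice bond field `B`, for a kernel
`H_{k,μν}(x; y)` indexed as in `KernelData.H` (directions `μ, ν`, `x ∈ T_η = Site P 0`, `y ∈ T₁^{(k)} = Site P k`; the bond `⟨x, μ⟩`
carries the component `μ` at `x`). [cite: BalabanImbrieJaffe1985, (7.2.1) p.325] -/
def applyKernel (k : ℕ) (H : Fin P.d → Fin P.d → Site P 0 → Site P k → ℝ) (B : VecField P k ℝ) : VecField P 0 ℝ :=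
  fun b => ∑ b' : PBond P k, H b.dir b'.dir b.src b'.src * B b'

/-- The column of the kernel at the unit-lattice bond `b = ⟨y, ν⟩`: the η-lattice bond field `x″, μ ↦ H_{k,μν}(x″; y)` (= `H_k` applied
to the unit field at `b`). [cite: BalabanImbrieJaffe1985, (7.2.1) p.325] -/
def column (k : ℕ) (H : Fin P.d → Fin P.d → Site P 0 → Site P k → ℝ) (b : PBond P k) : VecField P 0 ℝ :=
  fun b'' => H b''.dir b.dir b''.src b.src

/-- **`D_k` of (7.2.4)** p. 326 [PDF 28]: *"λ … depends on B through an exponentially decaying kernel D_k: λ(x) = (D_kB)(x)"* — for the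
concrete `λ(·)` of (5.1.13) (`lamOf c k`, lattice factor `c` of `∂`) and a kernel `H` of (7.2.1): `D_k(x, b) := λ(H_k(·; b))(x)`, the gauge
function of the column of `H_k` at `b`, evaluated at `x`. [cite: BalabanImbrieJaffe1985, (7.2.4) p.326] -/
noncomputable def Dk (c : ℝ) (k : ℕ) (H : Fin P.d → Fin P.d → Site P 0 → Site P k → ℝ) (x : Site P 0) (b : PBond P k) : ℝ :=
  lamOf c k (column k H b) x

/-- (7.2.1) is the superposition of the columns: `H_kB = Σ_b B(b)·H_k(·; b)`. [cite: BalabanImbrieJaffe1985, (7.2.1) p.325] -/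
theorem applyKernel_eq_sum (k : ℕ) (H : Fin P.d → Fin P.d → Site P 0 → Site P k → ℝ) (B : VecField P k ℝ) :
    applyKernel k H B = ∑ b : PBond P k, B b • column k H b := by
  funext b''
  simp only [applyKernel, column, Finset.sum_apply, Pi.smul_apply, smul_eq_mul]
  exact Finset.sum_congr rfl fun b _ => mul_comm _ _

/-- `λ(·)` is additive over finite sums (from `lamOf_add`, `lamOf_zero`). [cite: BalabanImbrieJaffe1985, (5.1.14) p.315] -/
theorem lamOf_sum {V : Type*} [AddCommGroup V] [Module ℝ V] (c : ℝ) (k : ℕ) {ι : Type*} (s : Finset ι)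
    (A : ι → VecField P 0 V) : lamOf c k (∑ i ∈ s, A i) = ∑ i ∈ s, lamOf c k (A i) := by
  classical
  induction s using Finset.induction_on with
  | empty => simp [lamOf_zero]
  | insert i s hi ih => rw [Finset.sum_insert hi, Finset.sum_insert hi, lamOf_add, ih]

/-- **(7.2.4), first clause — `λ(x) = (D_kB)(x)`**: for every unit-lattice bond field `B`, the gauge function (5.1.4) of `H_kB` is
`λ(H_kB)(x) = Σ_b D_k(x, b)·B(b)` (linearity of `λ(·)` in its argument, p. 315). [cite: BalabanImbrieJaffe1985, (7.2.4) p.326] -/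
theorem eq724_repr (c : ℝ) (k : ℕ) (H : Fin P.d → Fin P.d → Site P 0 → Site P k → ℝ) (B : VecField P k ℝ) (x : Site P 0) :
    lamOf c k (applyKernel k H B) x = ∑ b : PBond P k, Dk c k H x b * B b := by
  rw [applyKernel_eq_sum, lamOf_sum, Finset.sum_apply]
  refine Finset.sum_congr rfl fun b _ => ?_
  rw [lamOf_smul, Pi.smul_apply, smul_eq_mul, Dk, mul_comm]

/-! ## §2  The decay of `D_k` *"from (5.1.4) and (7.2.2)"* -/

/-- **The mechanism of (7.2.4).**  Suppose the kernel obeys the `|H|`-member of (7.2.2) in the form `|H_{k,μν}(x″; y)| ≤ M·e^{−δρ(x″_k, y)}`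
(decay measured from the unit block `B^k(x″_k)`, `x″_k = blk k x″`, through any `ρ`; `M ≥ 0`).  Then `|D_k(x, b)| ≤ Λ·M·e^{−δρ(x_k, b₋)}`,
`Λ = 2·d·((L−1)/2)·Σ_{j<k}L^j/|c|`: by locality `λ(H_k(·;b))(x)` only reads the column on the η-bonds of `B^k(x_k)`, where it is bounded by
the constant `M·e^{−δρ(x_k, b₋)}`, and `λ` is bounded (standing range `k ≤ m + K`). [cite: BalabanImbrieJaffe1985, (7.2.4) p.326] -/
theorem abs_Dk_le {k : ℕ} (hk : k ≤ P.m + P.K) (c : ℝ) (H : Fin P.d → Fin P.d → Site P 0 → Site P k → ℝ)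
    (ρ : Site P k → Site P k → ℝ) {M δ : ℝ} (hM : 0 ≤ M)
    (hH : ∀ (μ ν : Fin P.d) (x'' : Site P 0) (y : Site P k), |H μ ν x'' y| ≤ M * Real.exp (-(δ * ρ (blk k x'') y)))
    (x : Site P 0) (b : PBond P k) :
    |Dk c k H x b| ≤ (2 * ((P.d * ((P.L - 1) / 2) : ℕ) : ℝ) * (∑ j ∈ Finset.range k, (P.L : ℝ) ^ j) / |c|) *
      (M * Real.exp (-(δ * ρ (blk k x) b.src))) := by
  classical
  -- restrict the column to the tower of bonds over `x_k`
  set a : ℝ := M * Real.exp (-(δ * ρ (blk k x) b.src)) with ha_def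
  have ha : 0 ≤ a := mul_nonneg hM (Real.exp_pos _).le
  let G : VecField P 0 ℝ := fun b'' =>
    if blk k b''.src = blk k x ∧ blk k b''.tgt = blk k x then column k H b b'' else 0
  have hloc : lamOf c k (column k H b) x = lamOf c k G x :=
    lamOf_congr_tower hk c x fun b'' hs ht => by simp only [G, if_pos (And.intro hs ht)]
  have hG : ∀ b'' : PBond P 0, ‖G b''‖ ≤ a := by
    intro b''
    by_cases h : blk k b''.src = blk k x ∧ blk k b''.tgt = blk k x
    · simp only [G, if_pos h, column, Real.norm_eq_abs]
      have := hH b''.dir b.dir b''.src b.src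
      rwa [h.1] at this
    · simp only [G, if_neg h, norm_zero]; exact ha
  rw [Dk, hloc, ← Real.norm_eq_abs]
  exact norm_lamOf_le hk c G hG x

/-- The same at the PRINTED normalisation `c = L^k`: `|D_k(x, b)| ≤ d·(1 − L^{−k})·M·e^{−δρ(x_k, b₋)}` (≤ `d·M·e^{−δρ(x_k,b₋)}`, uniform
in `k` and in the volume). [cite: BalabanImbrieJaffe1985, (7.2.4) p.326] -/
theorem abs_Dk_le_unit {k : ℕ} (hk : k ≤ P.m + P.K) (H : Fin P.d → Fin P.d → Site P 0 → Site P k → ℝ)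
    (ρ : Site P k → Site P k → ℝ) {M δ : ℝ} (hM : 0 ≤ M)
    (hH : ∀ (μ ν : Fin P.d) (x'' : Site P 0) (y : Site P k), |H μ ν x'' y| ≤ M * Real.exp (-(δ * ρ (blk k x'') y)))
    (x : Site P 0) (b : PBond P k) :
    |Dk ((P.L : ℝ) ^ k) k H x b| ≤ P.d * (1 - ((P.L : ℝ) ^ k)⁻¹) * (M * Real.exp (-(δ * ρ (blk k x) b.src))) := by
  rw [← lamBound_unit]; exact abs_Dk_le hk _ H ρ hM hH x b

/-! ## §3  The `KernelData` instance and (7.2.4) as typed -/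

/-- **The Sect. 7.2 carrier instantiated on the V1 calculus** with the computed kernel `D_k`: η-lattice `T_η = Site P 0`, unit lattice
`T₁^{(k)} = Site P k`, unit bonds `PBond P k`, directions `Fin d`; `H` = the given kernel of (7.2.1); `D` = `Dk c k H` of (7.2.4); the
distances `|x − y|` (`distEU`), `|x − x′|` (`distEta`), `|y − y′|` (`distU`), `dist(x, b)` (`distEB`), the gradient data `|∇H|`, `|∇H − ∇H′|`
and the propagator kernel `C^{(k)}` of (7.2.2)–(7.2.3) are parameters (not used by (7.2.4)). [cite: BalabanImbrieJaffe1985, (7.2.1) p.325] -/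
noncomputable def kernelData (k : ℕ) (c : ℝ) (H : Fin P.d → Fin P.d → Site P 0 → Site P k → ℝ)
    (gradH : Fin P.d → Fin P.d → Site P 0 → Site P k → ℝ) (gradHDiff : Fin P.d → Fin P.d → Site P 0 → Site P 0 → Site P k → ℝ)
    (C : Fin P.d → Fin P.d → Site P k → Site P k → ℝ) (distEU : Site P 0 → Site P k → ℝ) (distEta : Site P 0 → Site P 0 → ℝ)
    (distU : Site P k → Site P k → ℝ) (distEB : Site P 0 → PBond P k → ℝ) : KernelData where
  SiteEta := Site P 0
  SiteU := Site P k
  BondU := PBond P k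
  Dir := Fin P.d
  distEU := distEU
  distEta := distEta
  distU := distU
  distEB := distEB
  H := H
  gradH := gradH
  gradHDiff := gradHDiff
  C := C
  D := Dk c k H

/-- The instance's `H_kB` of (7.2.1) is `applyKernel`: `(H_kB)_μ(x) = Σ_{y,ν} K.H μ ν x y · B_ν(y)`. [cite: BalabanImbrieJaffe1985, (7.2.1) p.325] -/
theorem kernelData_apply (k : ℕ) (c : ℝ) (H gradH : Fin P.d → Fin P.d → Site P 0 → Site P k → ℝ)
    (gradHDiff : Fin P.d → Fin P.d → Site P 0 → Site P 0 → Site P k → ℝ) (C : Fin P.d → Fin P.d → Site P k → Site P k → ℝ)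
    (distEU : Site P 0 → Site P k → ℝ) (distEta : Site P 0 → Site P 0 → ℝ) (distU : Site P k → Site P k → ℝ)
    (distEB : Site P 0 → PBond P k → ℝ) (B : VecField P k ℝ) (x : Site P 0) (μ : Fin P.d) :
    applyKernel k H B ⟨x, μ⟩ =
      ∑ b : PBond P k, (kernelData k c H gradH gradHDiff C distEU distEta distU distEB).H μ b.dir x b.src * B b := rfl

/-- **(7.2.4), first clause, for the instance**: `λ(H_kB)(x) = (D_kB)(x) = Σ_b K.D x b · B(b)`. [cite: BalabanImbrieJaffe1985, (7.2.4) p.326] -/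
theorem kernelData_repr (k : ℕ) (c : ℝ) (H gradH : Fin P.d → Fin P.d → Site P 0 → Site P k → ℝ)
    (gradHDiff : Fin P.d → Fin P.d → Site P 0 → Site P 0 → Site P k → ℝ) (C : Fin P.d → Fin P.d → Site P k → Site P k → ℝ)
    (distEU : Site P 0 → Site P k → ℝ) (distEta : Site P 0 → Site P 0 → ℝ) (distU : Site P k → Site P k → ℝ)
    (distEB : Site P 0 → PBond P k → ℝ) (B : VecField P k ℝ) (x : Site P 0) :
    lamOf c k (applyKernel k H B) x =
      ∑ b : PBond P k, (kernelData k c H gradH gradHDiff C distEU distEta distU distEB).D x b * B b :=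
  eq724_repr c k H B x

/-- **(7.2.4) AS TYPED (`KernelData.Ineq724`) for the instance, block-level distances**: if `distEU x″ y = ρ(x″_k, y)` and
`distEB x b = ρ(x_k, b₋)` for some `ρ` on the unit lattice, and the kernel obeys the `|H|`-member of (7.2.2) at `(M, δ)`
(`|K.H μ ν x″ y| ≤ M·e^{−δ·K.distEU x″ y}`, `M ≥ 0`), then `|K.D x b| ≤ (Λ·M)·e^{−δ·K.distEB x b}` with `Λ = 2·d·((L−1)/2)·Σ_{j<k}L^j/|c|`
(standing range). [cite: BalabanImbrieJaffe1985, (7.2.4) p.326] -/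
theorem ineq724_block {k : ℕ} (hk : k ≤ P.m + P.K) (c : ℝ) (H gradH : Fin P.d → Fin P.d → Site P 0 → Site P k → ℝ)
    (gradHDiff : Fin P.d → Fin P.d → Site P 0 → Site P 0 → Site P k → ℝ) (C : Fin P.d → Fin P.d → Site P k → Site P k → ℝ)
    (ρ : Site P k → Site P k → ℝ) (distEta : Site P 0 → Site P 0 → ℝ) (distU : Site P k → Site P k → ℝ) {M δ : ℝ} (hM : 0 ≤ M)
    (hH : ∀ (μ ν : Fin P.d) (x'' : Site P 0) (y : Site P k), |H μ ν x'' y| ≤ M * Real.exp (-(δ * ρ (blk k x'') y))) :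
    (kernelData k c H gradH gradHDiff C (fun x'' y => ρ (blk k x'') y) distEta distU (fun x b => ρ (blk k x) b.src)).Ineq724
      ((2 * ((P.d * ((P.L - 1) / 2) : ℕ) : ℝ) * (∑ j ∈ Finset.range k, (P.L : ℝ) ^ j) / |c|) * M) δ := by
  intro x b
  have h := abs_Dk_le hk c H ρ hM hH x b
  simp only [kernelData]
  linarith [h]

/-- `e^{−δt} ≤ e^{δs}·e^{−δt′}` whenever `t′ ≤ t + s` and `δ ≥ 0` (shifting a distance by a bounded amount costs a factor `e^{δs}`). [folklore] -/
private theorem exp_shift_le {δ s t t' : ℝ} (hδ : 0 ≤ δ) (h : t' ≤ t + s) :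
    Real.exp (-(δ * t)) ≤ Real.exp (δ * s) * Real.exp (-(δ * t')) := by
  rw [← Real.exp_add]
  exact Real.exp_le_exp.mpr (by nlinarith [mul_le_mul_of_nonneg_left h hδ])

/-- **(7.2.4) AS TYPED for the instance, general distances**: for ANY distance data of the carrier tied to the block geometry by
`ρ(x″_k, y) ≤ distEU x″ y + s` and `distEB x b ≤ ρ(x_k, b₋) + s′` (slacks `s, s′` — e.g. one unit-block diameter when `distEU`, `distEB`
are point distances and `ρ` a distance on `T₁^{(k)}`), the `|H|`-member of (7.2.2) at `(M, δ)` (`M, δ ≥ 0`) gives `KernelData.Ineq724` at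
`(Λ·M·e^{δ(s+s′)}, δ)`, `Λ = 2·d·((L−1)/2)·Σ_{j<k}L^j/|c|` — the printed *"This estimate follows from (5.1.4) and (7.2.2)"* (standing range).
[cite: BalabanImbrieJaffe1985, (7.2.4) p.326] -/
theorem ineq724 {k : ℕ} (hk : k ≤ P.m + P.K) (c : ℝ) (H gradH : Fin P.d → Fin P.d → Site P 0 → Site P k → ℝ)
    (gradHDiff : Fin P.d → Fin P.d → Site P 0 → Site P 0 → Site P k → ℝ) (C : Fin P.d → Fin P.d → Site P k → Site P k → ℝ)
    (distEU : Site P 0 → Site P k → ℝ) (distEta : Site P 0 → Site P 0 → ℝ) (distU : Site P k → Site P k → ℝ)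
    (distEB : Site P 0 → PBond P k → ℝ) (ρ : Site P k → Site P k → ℝ) {s s' M δ : ℝ} (hM : 0 ≤ M) (hδ : 0 ≤ δ)
    (hρE : ∀ (x'' : Site P 0) (y : Site P k), ρ (blk k x'') y ≤ distEU x'' y + s)
    (hρB : ∀ (x : Site P 0) (b : PBond P k), distEB x b ≤ ρ (blk k x) b.src + s')
    (hH : ∀ (μ ν : Fin P.d) (x'' : Site P 0) (y : Site P k), |H μ ν x'' y| ≤ M * Real.exp (-(δ * distEU x'' y))) :
    (kernelData k c H gradH gradHDiff C distEU distEta distU distEB).Ineq724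
      ((2 * ((P.d * ((P.L - 1) / 2) : ℕ) : ℝ) * (∑ j ∈ Finset.range k, (P.L : ℝ) ^ j) / |c|) * M * Real.exp (δ * (s + s'))) δ := by
  intro x b
  simp only [kernelData]
  set Λ : ℝ := 2 * ((P.d * ((P.L - 1) / 2) : ℕ) : ℝ) * (∑ j ∈ Finset.range k, (P.L : ℝ) ^ j) / |c| with hΛ
  have hΛ0 : 0 ≤ Λ := lamBound_nonneg P k c
  -- (7.2.2) read through the block geometry: `|H| ≤ (M e^{δs})·e^{−δρ(x″_k, y)}`
  have hH' : ∀ (μ ν : Fin P.d) (x'' : Site P 0) (y : Site P k),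
      |H μ ν x'' y| ≤ (M * Real.exp (δ * s)) * Real.exp (-(δ * ρ (blk k x'') y)) := by
    intro μ ν x'' y
    refine (hH μ ν x'' y).trans ?_
    rw [mul_assoc]
    exact mul_le_mul_of_nonneg_left (exp_shift_le hδ (hρE x'' y)) hM
  have hM' : 0 ≤ M * Real.exp (δ * s) := mul_nonneg hM (Real.exp_pos _).le
  have h := abs_Dk_le hk c H ρ hM' hH' x b
  -- back to the instance's `dist(x, b)`: `e^{−δρ(x_k,b₋)} ≤ e^{δs′}·e^{−δ·distEB x b}`
  have h2 : Real.exp (-(δ * ρ (blk k x) b.src)) ≤ Real.exp (δ * s') * Real.exp (-(δ * distEB x b)) :=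
    exp_shift_le hδ (hρB x b)
  calc |Dk c k H x b| ≤ Λ * (M * Real.exp (δ * s) * Real.exp (-(δ * ρ (blk k x) b.src))) := h
    _ ≤ Λ * (M * Real.exp (δ * s) * (Real.exp (δ * s') * Real.exp (-(δ * distEB x b)))) :=
        mul_le_mul_of_nonneg_left (mul_le_mul_of_nonneg_left h2 hM') hΛ0
    _ = Λ * M * Real.exp (δ * (s + s')) * Real.exp (-(δ * distEB x b)) := by
        rw [show δ * (s + s') = δ * s + δ * s' by ring, Real.exp_add]; ring


/-! ## §4  v1.1 (append-only): `dist(x, b)` measured from the fine site `x ∈ T_η` itself — the torus `ℓ¹` distance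
(torus-distance lemmas `tdist_triangle`, `val_blk`, `tdist_le_of_blk_eq` contributed by seat p03 gen 2, HOME/STATUS 2026-08-21T04:37:51Z,
staged draft `lit-balaban-p03/lean/BIJ85Ineq724Proof.DRAFT-unfiled-p03.lean`, incorporated here with thanks) -/

section FineDistance

variable {k : ℕ}

/-- **The mechanism of (7.2.4) with a FINE-SITE distance**: if `ρ(x, y)` (x ∈ T_η, y ∈ T₁^{(k)}) exceeds `ρ(u, y)` by at most `R` whenever
`u` lies in the unit block of `x` (`u_k = x_k`; e.g. `R` = one unit-block diameter), then `|H_{k,μν}(u; y)| ≤ Me^{−δρ(u,y)}` (`δ, M ≥ 0`)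
gives `|D_k(x, b)| ≤ Λ·(e^{δR}M)·e^{−δρ(x, b₋)}`, `Λ = 2·d·((L−1)/2)·Σ_{j<k}L^j/|c|` (locality + boundedness of `λ`, as in `abs_Dk_le`).
[cite: BalabanImbrieJaffe1985, (7.2.4) p.326] -/
theorem abs_Dk_le_fine (hk : k ≤ P.m + P.K) (c : ℝ) (H : Fin P.d → Fin P.d → Site P 0 → Site P k → ℝ)
    (ρ : Site P 0 → Site P k → ℝ) {M δ R : ℝ} (hδ : 0 ≤ δ) (hM : 0 ≤ M)
    (hρ : ∀ (u x : Site P 0) (y : Site P k), blk k u = blk k x → ρ x y ≤ ρ u y + R)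
    (hH : ∀ (μ ν : Fin P.d) (u : Site P 0) (y : Site P k), |H μ ν u y| ≤ M * Real.exp (-(δ * ρ u y)))
    (x : Site P 0) (b : PBond P k) :
    |Dk c k H x b| ≤ (2 * ((P.d * ((P.L - 1) / 2) : ℕ) : ℝ) * (∑ j ∈ Finset.range k, (P.L : ℝ) ^ j) / |c|) *
      ((Real.exp (δ * R) * M) * Real.exp (-(δ * ρ x b.src))) := by
  classical
  set a : ℝ := (Real.exp (δ * R) * M) * Real.exp (-(δ * ρ x b.src)) with ha_def
  have ha : 0 ≤ a := by positivity
  let G : VecField P 0 ℝ := fun b'' =>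
    if blk k b''.src = blk k x ∧ blk k b''.tgt = blk k x then column k H b b'' else 0
  have hloc : lamOf c k (column k H b) x = lamOf c k G x :=
    lamOf_congr_tower hk c x fun b'' hs ht => by simp only [G, if_pos (And.intro hs ht)]
  have hG : ∀ b'' : PBond P 0, ‖G b''‖ ≤ a := by
    intro b''
    by_cases h : blk k b''.src = blk k x ∧ blk k b''.tgt = blk k x
    · simp only [G, if_pos h, column, Real.norm_eq_abs]
      have h1 := hH b''.dir b.dir b''.src b.src
      have h2 : Real.exp (-(δ * ρ b''.src b.src)) ≤ Real.exp (δ * R) * Real.exp (-(δ * ρ x b.src)) := by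
        rw [← Real.exp_add]
        exact Real.exp_le_exp.mpr (by nlinarith [mul_le_mul_of_nonneg_left (hρ b''.src x b.src h.1) hδ])
      calc |H b''.dir b.dir b''.src b.src| ≤ M * Real.exp (-(δ * ρ b''.src b.src)) := h1
        _ ≤ M * (Real.exp (δ * R) * Real.exp (-(δ * ρ x b.src))) := mul_le_mul_of_nonneg_left h2 hM
        _ = a := by rw [ha_def]; ring
    · simp only [G, if_neg h, norm_zero]; exact ha
  rw [Dk, hloc, ← Real.norm_eq_abs]
  exact norm_lamOf_le hk c G hG x

/-- Subadditivity of the circular size `min(val a, val(−a))` on `ℤ/N` (p03 gen 2). [folklore] -/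
private theorem circ_add_le {N : ℕ} [NeZero N] (a b : ZMod N) :
    min (a + b).val (-(a + b)).val ≤ min a.val (-a).val + min b.val (-b).val := by
  rcases le_total a.val (-a).val with ha | ha <;> rcases le_total b.val (-b).val with hb | hb
  · rw [min_eq_left ha, min_eq_left hb]
    exact (min_le_left _ _).trans (ZMod.val_add_le a b)
  · rw [min_eq_left ha, min_eq_right hb]
    rcases le_total (-b).val a.val with h | h
    · have e : a + b = a - -b := by ring
      calc min (a + b).val (-(a + b)).val ≤ (a + b).val := min_le_left _ _
        _ = a.val - (-b).val := by rw [e, ZMod.val_sub h]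
        _ ≤ a.val + (-b).val := by omega
    · have e : -(a + b) = -b - a := by ring
      calc min (a + b).val (-(a + b)).val ≤ (-(a + b)).val := min_le_right _ _
        _ = (-b).val - a.val := by rw [e, ZMod.val_sub h]
        _ ≤ a.val + (-b).val := by omega
  · rw [min_eq_right ha, min_eq_left hb]
    rcases le_total (-a).val b.val with h | h
    · have e : a + b = b - -a := by ring
      calc min (a + b).val (-(a + b)).val ≤ (a + b).val := min_le_left _ _
        _ = b.val - (-a).val := by rw [e, ZMod.val_sub h]
        _ ≤ (-a).val + b.val := by omega
    · have e : -(a + b) = -a - b := by ring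
      calc min (a + b).val (-(a + b)).val ≤ (-(a + b)).val := min_le_right _ _
        _ = (-a).val - b.val := by rw [e, ZMod.val_sub h]
        _ ≤ (-a).val + b.val := by omega
  · rw [min_eq_right ha, min_eq_right hb]
    have e : -(a + b) = -a + -b := by ring
    calc min (a + b).val (-(a + b)).val ≤ (-(a + b)).val := min_le_right _ _
      _ ≤ (-a).val + (-b).val := by rw [e]; exact ZMod.val_add_le _ _

/-- Triangle inequality for the `ℓ¹` torus distance `Site.tdist` of `Setup` (lattice steps; p03 gen 2). [folklore: metric on (ℤ/N)^d] -/
private theorem tdist_triangle {j : ℕ} (x y z : Site P j) : Site.tdist x z ≤ Site.tdist x y + Site.tdist y z := by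
  unfold Site.tdist
  rw [← Finset.sum_add_distrib]
  refine Finset.sum_le_sum fun μ _ => ?_
  have e1 : x μ - z μ = (x μ - y μ) + (y μ - z μ) := by ring
  have e2 : z μ - x μ = -((x μ - y μ) + (y μ - z μ)) := by ring
  have e3 : y μ - x μ = -(x μ - y μ) := by ring
  have e4 : z μ - y μ = -(y μ - z μ) := by ring
  rw [e1, e2, e3, e4]
  exact circ_add_le _ _

/-- The label of the unit block of a fine site: `(x_k)_μ = ⌊x_μ/L^k⌋` (iterating `TorusGeometry.val_blockOf`; standing range; p03 gen 2).
[cite: BalabanImbrieJaffe1985, (5.1.2)–(5.1.3) pp.313–314] -/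
theorem val_blk : ∀ (k : ℕ), k ≤ P.m + P.K → ∀ (x : Site P 0) (μ : Fin P.d), ((blk k x) μ).val = (x μ).val / P.L ^ k
  | 0, _, x, μ => by simp [blk]
  | k + 1, hk, x, μ => by
    rw [blk_succ, Site.val_blockOf (by omega), val_blk k (by omega) x μ, Nat.div_div_eq_div_mul, pow_succ]

/-- `⌊a/N⌋ = ⌊b/N⌋` forces `a − b ≤ N − 1`. [folklore] -/
private theorem sub_le_pred_of_div_eq {N a b : ℕ} (hN : 0 < N) (h : a / N = b / N) : a - b ≤ N - 1 := by
  have h1 : a < a / N * N + N := Nat.lt_div_mul_add hN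
  have h2 : b / N * N ≤ b := Nat.div_mul_le_self b N
  rw [h] at h1
  omega

/-- Two fine sites of the same unit block `B^k(y)` are at most `d(L^k − 1)` lattice steps apart (`B^k(y)` is a cube of side `L^k` of
`T_η`, B12 (0.3); p03 gen 2). [cite: BalabanImbrieJaffe1985, (5.1.2) p.313] -/
theorem tdist_le_of_blk_eq (hk : k ≤ P.m + P.K) {u x : Site P 0} (h : blk k u = blk k x) :
    Site.tdist u x ≤ P.d * (P.L ^ k - 1) := by
  unfold Site.tdist
  calc ∑ μ : Fin P.d, min (u μ - x μ).val (x μ - u μ).val ≤ ∑ _μ : Fin P.d, (P.L ^ k - 1) :=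
      Finset.sum_le_sum fun μ _ => ?_
    _ = P.d * (P.L ^ k - 1) := by rw [Finset.sum_const, Finset.card_univ, Fintype.card_fin, smul_eq_mul]
  have hq : (u μ).val / P.L ^ k = (x μ).val / P.L ^ k := by rw [← val_blk k hk u μ, ← val_blk k hk x μ, h]
  rcases le_total (x μ).val (u μ).val with hle | hle
  · calc min (u μ - x μ).val (x μ - u μ).val ≤ (u μ - x μ).val := min_le_left _ _
      _ = (u μ).val - (x μ).val := ZMod.val_sub hle
      _ ≤ P.L ^ k - 1 := sub_le_pred_of_div_eq (pow_pos P.L_pos k) hq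
  · calc min (u μ - x μ).val (x μ - u μ).val ≤ (x μ - u μ).val := min_le_right _ _
      _ = (x μ).val - (u μ).val := ZMod.val_sub hle
      _ ≤ P.L ^ k - 1 := sub_le_pred_of_div_eq (pow_pos P.L_pos k) hq.symm

/-- The sub-block excess of the fine `ℓ¹` distance in unit-lattice units: for `u` in the unit block of `x`,
`η·|x − z|₁ ≤ η·|u − z|₁ + d` (`η = L^{−k}`, `η·d(L^k − 1) ≤ d`). [cite: BalabanImbrieJaffe1985, (5.1.2) p.313] -/
theorem eta_tdist_excess_le (hk : k ≤ P.m + P.K) {u x : Site P 0} (h : blk k u = blk k x) (z : Site P 0) :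
    ((P.L : ℝ) ^ k)⁻¹ * (Site.tdist x z : ℝ) ≤ ((P.L : ℝ) ^ k)⁻¹ * (Site.tdist u z : ℝ) + P.d := by
  have hLk : (0 : ℝ) < (P.L : ℝ) ^ k := pow_pos (Nat.cast_pos.mpr P.L_pos) _
  have h1 : (Site.tdist x z : ℝ) ≤ Site.tdist x u + Site.tdist u z := by exact_mod_cast tdist_triangle x u z
  have h2 : (Site.tdist x u : ℝ) ≤ P.d * ((P.L : ℝ) ^ k - 1) := by
    have := tdist_le_of_blk_eq hk (u := x) (x := u) h.symm
    have hcast : ((P.L ^ k - 1 : ℕ) : ℝ) = (P.L : ℝ) ^ k - 1 := by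
      rw [Nat.cast_sub (Nat.one_le_pow _ _ P.L_pos)]; push_cast; ring
    calc (Site.tdist x u : ℝ) ≤ ((P.d * (P.L ^ k - 1) : ℕ) : ℝ) := by exact_mod_cast this
      _ = P.d * ((P.L : ℝ) ^ k - 1) := by rw [Nat.cast_mul, hcast]
  have h3 : ((P.L : ℝ) ^ k)⁻¹ * (P.d * ((P.L : ℝ) ^ k - 1)) ≤ P.d := by
    rw [inv_mul_le_iff₀ hLk]
    have : (0 : ℝ) ≤ P.d := Nat.cast_nonneg _
    nlinarith
  calc ((P.L : ℝ) ^ k)⁻¹ * (Site.tdist x z : ℝ)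
      ≤ ((P.L : ℝ) ^ k)⁻¹ * (Site.tdist x u + Site.tdist u z) := mul_le_mul_of_nonneg_left h1 (inv_nonneg.mpr hLk.le)
    _ = ((P.L : ℝ) ^ k)⁻¹ * Site.tdist x u + ((P.L : ℝ) ^ k)⁻¹ * Site.tdist u z := by ring
    _ ≤ ((P.L : ℝ) ^ k)⁻¹ * (P.d * ((P.L : ℝ) ^ k - 1)) + ((P.L : ℝ) ^ k)⁻¹ * Site.tdist u z := by gcongr
    _ ≤ ((P.L : ℝ) ^ k)⁻¹ * Site.tdist u z + P.d := by linarith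

/-- **(7.2.4) AS TYPED with the PRINTED reading of the distances** — `|x − y|` and `dist(x, b)` measured from the fine site `x ∈ T_η`
itself: the torus `ℓ¹` distance of `T_η` in unit-lattice units, `η·|x − ι(y)|₁` (`η = L^{−k}`), to any placement `ι : T₁^{(k)} → T_η` of the
unit lattice (e.g. the block centres).  The `|H|`-member of (7.2.2) at `(M, δ)` (`M, δ ≥ 0`) gives `KernelData.Ineq724 (Λ·e^{δd}·M) δ` for the
instance (`Λ = 2·d·((L−1)/2)·Σ_{j<k}L^j/|c|`), the sub-block excess being `≤ d` (`eta_tdist_excess_le`).  [cite: BalabanImbrieJaffe1985, (7.2.4) p.326] -/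
theorem ineq724_tdist (hk : k ≤ P.m + P.K) (c : ℝ) (H gradH : Fin P.d → Fin P.d → Site P 0 → Site P k → ℝ)
    (gradHDiff : Fin P.d → Fin P.d → Site P 0 → Site P 0 → Site P k → ℝ) (C : Fin P.d → Fin P.d → Site P k → Site P k → ℝ)
    (ι : Site P k → Site P 0) (distEta : Site P 0 → Site P 0 → ℝ) (distU : Site P k → Site P k → ℝ) {M δ : ℝ} (hM : 0 ≤ M)
    (hδ : 0 ≤ δ)
    (hH : ∀ (μ ν : Fin P.d) (u : Site P 0) (y : Site P k),
      |H μ ν u y| ≤ M * Real.exp (-(δ * (((P.L : ℝ) ^ k)⁻¹ * Site.tdist u (ι y))))) :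
    (kernelData k c H gradH gradHDiff C (fun u y => ((P.L : ℝ) ^ k)⁻¹ * Site.tdist u (ι y)) distEta distU
        (fun x b => ((P.L : ℝ) ^ k)⁻¹ * Site.tdist x (ι b.src))).Ineq724
      ((2 * ((P.d * ((P.L - 1) / 2) : ℕ) : ℝ) * (∑ j ∈ Finset.range k, (P.L : ℝ) ^ j) / |c|) * (Real.exp (δ * P.d) * M)) δ := by
  intro x b
  simp only [kernelData]
  have h := abs_Dk_le_fine hk c H (fun u y => ((P.L : ℝ) ^ k)⁻¹ * (Site.tdist u (ι y) : ℝ)) (R := (P.d : ℝ)) hδ hM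
    (fun u x' y hux => eta_tdist_excess_le hk hux (ι y)) hH x b
  simpa only [mul_assoc] using h

end FineDistance

end Literature.MathematicalPhysics.QuantumFieldTheory.BalabanImbrieJaffe1984to88.BIJ85Ineq724Proof
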